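import Summits.BirchSwinnertonDyer.Rank1Residual.Additive.SupersingularTwistTowerThree
import Summits.BirchSwinnertonDyer.Rank1Residual.Additive.XGssRankZeroCyclotomicThreeSharpFacts
import HarnessLib

/-!
# X4 at `p = 3`, good SUPERSINGULAR twist `a₃(V) = 0`, line V18 in its ℚ-side SHARP form WITHOUT the
# (ram) bit (cell `b2b-bsdres`, team n1011, seat p05, OWNERS row T-b1ss = T-b2 downstream (i), part 2)

HONEST FRAMING (cell `b2b-bsdres`, run/shared/lean/b2b/bsd-rank1-residual/, verbatim in every
file): the goal of the cell is to DELETE the COMBINATION-SHAPED residual classes of the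
Birch–Swinnerton-Dyer formula for ALL analytic-rank `≤ 1` elliptic curves over `ℚ` — "full BSD
formula for every rank `≤ 1` curve in class `C`" assembled STRICTLY from published theorems — so
that the rank-`≤ 1` remainder becomes exactly the CONSTRUCTION-SHAPED classes, which are TYPED
(missing-input `Prop`s), NOT attempted. This is not "finishing BSD". Team n1011 (N10 / N11, the
additive block X4 ∧ `p = 3`): research route on the CONSTRUCTION-SHAPED class X4; no claim beyond the
stated classes; the label X4 is UNCHANGED by this file; nothing is booked. Theorems only (no
definition, no named fact minted; every published input is an explicit named-fact hypothesis).

## What this file proves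

The sibling `SupersingularTwistTowerThree.lean` removed the census bit `ram(3)` from additive-p4's line
V18 (`K`-side form).  This file does the same for the ℚ-side SHARP form
(`XGssRankZeroCyclotomicThreeSharpFacts.lean`: Tamagawa bits `3 ∤ ∏c(V)`, `3 ∤ ∏c(W)` instead of
`3 ∤ ∏_w c_w(V_K)`; no Milne): `XGssCyclotomicThreeSharp.exists_padicVal_shaOrder_add_le_of_facts_of_surj`,
`XGssCyclotomicThreeSharp.missingUpperBoundAt_of_surj`, `XGssCyclotomicThreeSharp.bsdp_of_units_of_surj`,
`ClassX4.exists_padicVal_shaOrder_add_le_three_of_ssTwist_sharp_noRam`,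
`ClassX4.bsdp_three_of_ssTwist_of_units_noRam`.  The (ram) bit served only the tower of `V`
(`towerSurj_twist_of_good_of_surj`, Wuthrich's Lemma 20 as a tree theorem) and `V(K_∞)[3^∞] = 0`
(`fixedPoints_kerSubgroup_eq_bot_of_irr`).

References: [Wuthrich2014] Lemma 20 (p. 399); [Kobayashi2003] Thm. 4.1; [KitajimaOtsuki2018] Main
Thm. 1.3; [DokchitserDokchitserAnnals2010] Lemma 4.14; [Miller2011LMS] Def. 1.1.
-/

noncomputable section

open scoped Classical MatrixGroups ModularForm

open CongruenceSubgroup WeierstrassCurve NumberField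
  Literature.NumberTheory.EllipticCurves Literature.NumberTheory.EllipticCurves.ModularForms
  Literature.NumberTheory.EllipticCurves.Rank1Residual
  Literature.NumberTheory.EllipticCurves.Rank1Residual.Typed
  Literature.NumberTheory.EllipticCurves.Kobayashi2003
  Literature.NumberTheory.GaloisRepresentations

namespace Summit.BirchSwinnertonDyer.Rank1Residual.Additive

variable (V : WeierstrassCurve ℚ) [V.IsElliptic] [V.IsGloballyMinimal]
  (W : WeierstrassCurve ℚ) [W.IsElliptic] [W.IsGloballyMinimal]

/-- **Line V18 (ℚ-side sharp form), core inequality, image from `surj(3)` of `W` ALONE (no (ram)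
bit)**: `ord₃#Ш(V) + ord₃#Ш(W) + 2(ord₃#V(ℚ) + ord₃#W(ℚ)) ≤ ord₃#Ш_an(V) + ord₃#Ш_an(W) + ord₃∏c(V) + ord₃∏c(W)`
for `C • V^{(−3)} = W`, `V` good at `3` with `a₃(V) = 0`, `W` additive at `3` with `ρ̄_{W,3}` onto, ranks
`(0,0)`; additive-p4's `XGssCyclotomicThreeSharp.exists_padicVal_shaOrder_add_le_of_facts_of_surj_of_ram`
with `ram(3)` deleted (tower of `V`: `towerSurj_twist_of_good_of_surj`; `V(K_∞)[3^∞] = 0`: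
`fixedPoints_kerSubgroup_eq_bot_of_irr`). [cite: Kobayashi2003, Thm. 4.1 (p. 8)] [cite: KitajimaOtsuki2018, Main Thm. 1.3]
[cite: DokchitserDokchitserAnnals2010, Lemma 4.14 (proof)] [cite: Wuthrich2014, Lemma 20 (p. 399)] -/
theorem XGssCyclotomicThreeSharp.exists_padicVal_shaOrder_add_le_of_facts_of_surj
    (hKob : Kobayashi2003.thm41_plusCharIdeal_dvd_cyclotomicThree)
    (hKO : KitajimaOtsuki2018.mainThm13_plusSelmerDual_noFiniteSubmodule)
    (hPol : ∀ {N : ℕ} [NeZero N] (f : CuspForm (Gamma0 N) 2),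
      pollack_exists_plusMinusPAdicLFunction (W := V) (f := f) (p := 3))
    (hGZK : rank_eq_analyticRank_of_analyticRank_le_one) (hmod : hasEntireLFunction_rat)
    (hmodD : nonempty_modularParametrizationData)
    (C : VariableChange ℚ) (hC : C • V.quadraticTwist (-(3 : ℚ)) = W)
    (hgood : V.HasGoodReductionAtPrime 3) (ha3 : V.frobeniusTrace 3 = 0)
    (hsurj : Surj W 3) (hadd : Addv W 3) (hrV : V.analyticRank = 0) (hrW : W.analyticRank = 0) :
    ∃ qV qW : ℚ, shaAn V = (qV : ℂ) ∧ shaAn W = (qW : ℂ) ∧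
      (padicValNat 3 V.shaOrder : ℤ) + padicValNat 3 W.shaOrder +
          2 * (padicValNat 3 (Nat.card V.toAffine.Point) + padicValNat 3 (Nat.card W.toAffine.Point)) ≤
        padicValRat 3 qV + padicValRat 3 qW +
          padicValNat 3 V.tamagawaProduct + padicValNat 3 W.tamagawaProduct := by
  haveI : IsCyclotomicExtension {3} ℚ (CyclotomicField 3 ℚ) := CyclotomicField.isCyclotomicExtension 3 ℚ
  have h2 : Module.finrank ℚ (CyclotomicField 3 ℚ) = 2 :=
    finrank_eq_two_of_isCyclotomicExtension_three (K := CyclotomicField 3 ℚ)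
  have hsurjV : Surj V 3 :=
    (surj_iff_of_model_twist V 3 (d := -(3 : ℚ)) (by norm_num) ⟨C, hC⟩).mp hsurj
  have hirrV : Irr V 3 := irr_of_surj V 3 hsurjV
  have htower : ∀ n : ℕ, V.HasSurjectiveModNGaloisRep (3 ^ n : ℕ) :=
    towerSurj_twist_of_good_of_surj V W C hC hgood hsurj
  -- the newform, the two rational period ratios, Pollack's `L₃⁺(V, X)`
  haveI : NeZero (V.conductorNorm ℤ) := ⟨(V.conductorNorm_pos_holds).ne'⟩
  obtain ⟨Dm⟩ := hmodD V
  have hf : IsNewformOf V Dm.f := Dm.isNewformOf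
  obtain ⟨ϖ, -, hϖ, -⟩ := Dm.exists_rat_mul_realPeriodRat_eq_plusPeriod
  obtain ⟨ϖ', -, hϖ'⟩ := exists_rat_mul_imaginaryPeriodRat_eq_minusPeriod Dm
  obtain ⟨L, -, hL⟩ := exists_isSignedPAdicLFunction (hPol Dm.f) (by norm_num) hf hgood ha3 1
  haveI : (V.baseChange (CyclotomicField 3 ℚ)).IsElliptic := by rw [baseChange]; infer_instance
  refine XGssRankZeroCyclotomicThree.exists_padicVal_shaOrder_add_le_sharp (CyclotomicField 3 ℚ) V W
    hGZK hmod C hC hgood ha3 hadd hrV hrW hf ϖ ϖ' hϖ hϖ' L hL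
    (exists_isCyclotomic_isTopGenerator_cyclotomicThree (CyclotomicField 3 ℚ))
    (fun κ ↦ fixedPoints_kerSubgroup_eq_bot_of_irr V 3 hirrV (CyclotomicField 3 ℚ) h2 κ)
    (fun κ γ hκ hγ hγ' D ↦ ?_) (fun κ γ hκ hγ D _ hX N' hN' ↦ ?_)
  · obtain ⟨hfin, hX, Lω, hLω, -, hsurj'⟩ := hKob V (CyclotomicField 3 ℚ)
      (V.baseChange (CyclotomicField 3 ℚ)) hgood ha3 ⟨1, one_smul _ _⟩ hκ hγ hγ' hf L hL D ϖ ϖ' hϖ hϖ'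
    exact ⟨hfin, hX, Lω, hLω, hsurj' htower⟩
  · exact hKO V 3 (by norm_num) hgood ha3 (CyclotomicField 3 ℚ) (V.baseChange (CyclotomicField 3 ℚ))
      ⟨1, one_smul _ _⟩ κ γ hκ hγ D hX N' hN'

/-- **Line V18 sharp, typed UPPER half for the additive curve, no (ram) bit** (`3 ∤ #Ш_an(V)`,
`3 ∤ ∏c(V)·∏c(W)`). [cite: Kobayashi2003, Thm. 4.1 (p. 8)] [cite: KitajimaOtsuki2018, Main Thm. 1.3]
[cite: Wuthrich2014, Lemma 20 (p. 399)] -/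
theorem XGssCyclotomicThreeSharp.missingUpperBoundAt_of_surj
    (hKob : Kobayashi2003.thm41_plusCharIdeal_dvd_cyclotomicThree)
    (hKO : KitajimaOtsuki2018.mainThm13_plusSelmerDual_noFiniteSubmodule)
    (hPol : ∀ {N : ℕ} [NeZero N] (f : CuspForm (Gamma0 N) 2),
      pollack_exists_plusMinusPAdicLFunction (W := V) (f := f) (p := 3))
    (hGZK : rank_eq_analyticRank_of_analyticRank_le_one) (hmod : hasEntireLFunction_rat)
    (hmodD : nonempty_modularParametrizationData)
    (C : VariableChange ℚ) (hC : C • V.quadraticTwist (-(3 : ℚ)) = W)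
    (hgood : V.HasGoodReductionAtPrime 3) (ha3 : V.frobeniusTrace 3 = 0)
    (hsurj : Surj W 3) (hadd : Addv W 3) (hrV : V.analyticRank = 0) (hrW : W.analyticRank = 0)
    {qV : ℚ} (hqV : shaAn V = (qV : ℂ)) (hv : padicValRat 3 qV ≤ 0)
    (htamV : padicValNat 3 V.tamagawaProduct = 0) (htamW : padicValNat 3 W.tamagawaProduct = 0) :
    MissingUpperBoundAt W 3 := by
  obtain ⟨qV', qW, hqV', hqW, hle⟩ :=
    XGssCyclotomicThreeSharp.exists_padicVal_shaOrder_add_le_of_facts_of_surj V W hKob hKO hPol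
      hGZK hmod hmodD C hC hgood ha3 hsurj hadd hrV hrW
  have hqq : qV' = qV := by exact_mod_cast hqV'.symm.trans hqV
  subst hqq
  refine ⟨qW, hqW, ?_⟩
  have h0 : (0 : ℤ) ≤ padicValNat 3 V.shaOrder := by positivity
  have h1 : (0 : ℤ) ≤ padicValNat 3 (Nat.card V.toAffine.Point) := by positivity
  have h1' : (0 : ℤ) ≤ padicValNat 3 (Nat.card W.toAffine.Point) := by positivity
  rw [htamV, htamW, Nat.cast_zero, add_zero, add_zero] at hle
  linarith

/-- **Line V18 sharp, `BSD(W,3) ∧ BSD(V,3)` on the ℚ-side unit rows, no (ram) bit** (`#Ш_an(V)`,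
`#Ш_an(W)`, `∏c(V)`, `∏c(W)` all `3`-adic units; census bit `surj(3)` only).  Labels UNCHANGED; nothing
booked by this theorem. [cite: Kobayashi2003, Thm. 4.1 (p. 8)] [cite: KitajimaOtsuki2018, Main Thm. 1.3]
[cite: DokchitserDokchitserAnnals2010, Lemma 4.14 (proof)] [cite: Miller2011LMS, §1 and Def. 1.1]
[cite: Wuthrich2014, Lemma 20 (p. 399)] -/
theorem XGssCyclotomicThreeSharp.bsdp_of_units_of_surj
    (hKob : Kobayashi2003.thm41_plusCharIdeal_dvd_cyclotomicThree)
    (hKO : KitajimaOtsuki2018.mainThm13_plusSelmerDual_noFiniteSubmodule)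
    (hPol : ∀ {N : ℕ} [NeZero N] (f : CuspForm (Gamma0 N) 2),
      pollack_exists_plusMinusPAdicLFunction (W := V) (f := f) (p := 3))
    (hGZK : rank_eq_analyticRank_of_analyticRank_le_one) (hmod : hasEntireLFunction_rat)
    (hmodD : nonempty_modularParametrizationData)
    (C : VariableChange ℚ) (hC : C • V.quadraticTwist (-(3 : ℚ)) = W)
    (hgood : V.HasGoodReductionAtPrime 3) (ha3 : V.frobeniusTrace 3 = 0)
    (hsurj : Surj W 3) (hadd : Addv W 3) (hrV : V.analyticRank = 0) (hrW : W.analyticRank = 0)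
    {qV qW : ℚ} (hqV : shaAn V = (qV : ℂ)) (hqW : shaAn W = (qW : ℂ))
    (hvV : padicValRat 3 qV = 0) (hvW : padicValRat 3 qW = 0)
    (htamV : padicValNat 3 V.tamagawaProduct = 0) (htamW : padicValNat 3 W.tamagawaProduct = 0) :
    BSDp W 3 ∧ BSDp V 3 := by
  obtain ⟨qV', qW', hqV', hqW', hle⟩ :=
    XGssCyclotomicThreeSharp.exists_padicVal_shaOrder_add_le_of_facts_of_surj V W hKob hKO hPol
      hGZK hmod hmodD C hC hgood ha3 hsurj hadd hrV hrW
  have hqq : qV' = qV := by exact_mod_cast hqV'.symm.trans hqV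
  have hqq' : qW' = qW := by exact_mod_cast hqW'.symm.trans hqW
  subst hqq hqq'
  rw [hvV, hvW, htamV, htamW, Nat.cast_zero, add_zero, add_zero, add_zero] at hle
  have hV0 : (0 : ℤ) ≤ padicValNat 3 V.shaOrder := by positivity
  have hW0 : (0 : ℤ) ≤ padicValNat 3 W.shaOrder := by positivity
  have hK0 : (0 : ℤ) ≤ padicValNat 3 (Nat.card V.toAffine.Point) := by positivity
  have hK0' : (0 : ℤ) ≤ padicValNat 3 (Nat.card W.toAffine.Point) := by positivity
  have huW : MissingUpperBoundAt W 3 := ⟨qW', hqW', by rw [hvW]; linarith⟩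
  have huV : MissingUpperBoundAt V 3 := ⟨qV', hqV', by rw [hvV]; linarith⟩
  exact ⟨bsdp_of_missingPPartAt W 3 hGZK (by rw [hrW]; exact zero_le_one)
      (missingPPartAt_of_upper_of_shaAn_unit W 3 huW hqW' hvW),
    bsdp_of_missingPPartAt V 3 hGZK (by rw [hrV]; exact zero_le_one)
      (missingPPartAt_of_upper_of_shaAn_unit V 3 huV hqV' hvV)⟩

/-- **X4 at `p = 3`, CLASS level, supersingular twist, ℚ-side sharp form, no (ram) bit: the sum
inequality** (`ClassX4.exists_padicVal_shaOrder_add_le_three_of_ssTwist_sharp` minus `ram(3)`).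
[cite: Kobayashi2003, Thm. 4.1 (p. 8)] [cite: KitajimaOtsuki2018, Main Thm. 1.3] [cite: Wuthrich2014, Lemma 20 (p. 399)] -/
theorem ClassX4.exists_padicVal_shaOrder_add_le_three_of_ssTwist_sharp_noRam
    (hKob : Kobayashi2003.thm41_plusCharIdeal_dvd_cyclotomicThree)
    (hKO : KitajimaOtsuki2018.mainThm13_plusSelmerDual_noFiniteSubmodule)
    (hPol : ∀ {N : ℕ} [NeZero N] (f : CuspForm (Gamma0 N) 2),
      pollack_exists_plusMinusPAdicLFunction (W := V) (f := f) (p := 3))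
    (hGZK : rank_eq_analyticRank_of_analyticRank_le_one) (hmod : hasEntireLFunction_rat)
    (hmodD : nonempty_modularParametrizationData)
    (hX : ClassX4 W 3) (hsurj : Surj W 3)
    (C : VariableChange ℚ) (hC : C • V.quadraticTwist (-(3 : ℚ)) = W)
    (hgood : V.HasGoodReductionAtPrime 3) (ha3 : V.frobeniusTrace 3 = 0)
    (hrV : V.analyticRank = 0) (hrW : W.analyticRank = 0) :
    ∃ qV qW : ℚ, shaAn V = (qV : ℂ) ∧ shaAn W = (qW : ℂ) ∧
      (padicValNat 3 V.shaOrder : ℤ) + padicValNat 3 W.shaOrder +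
          2 * (padicValNat 3 (Nat.card V.toAffine.Point) + padicValNat 3 (Nat.card W.toAffine.Point)) ≤
        padicValRat 3 qV + padicValRat 3 qW +
          padicValNat 3 V.tamagawaProduct + padicValNat 3 W.tamagawaProduct :=
  XGssCyclotomicThreeSharp.exists_padicVal_shaOrder_add_le_of_facts_of_surj V W hKob hKO hPol
    hGZK hmod hmodD C hC hgood ha3 hsurj hX.2.1 hrV hrW

/-- **X4 at `p = 3`, class level, supersingular twist: `BSD(W,3) ∧ BSD(V,3)` on the ℚ-side unit rows
from the census bit `surj(3)` ONLY** (`ClassX4.bsdp_three_of_ssTwist_of_units` minus `ram(3)`); labels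
UNCHANGED; nothing booked by this theorem. [cite: Kobayashi2003, Thm. 4.1 (p. 8)]
[cite: KitajimaOtsuki2018, Main Thm. 1.3] [cite: Miller2011LMS, §1 and Def. 1.1] [cite: Wuthrich2014, Lemma 20 (p. 399)] -/
theorem ClassX4.bsdp_three_of_ssTwist_of_units_noRam
    (hKob : Kobayashi2003.thm41_plusCharIdeal_dvd_cyclotomicThree)
    (hKO : KitajimaOtsuki2018.mainThm13_plusSelmerDual_noFiniteSubmodule)
    (hPol : ∀ {N : ℕ} [NeZero N] (f : CuspForm (Gamma0 N) 2),
      pollack_exists_plusMinusPAdicLFunction (W := V) (f := f) (p := 3))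
    (hGZK : rank_eq_analyticRank_of_analyticRank_le_one) (hmod : hasEntireLFunction_rat)
    (hmodD : nonempty_modularParametrizationData)
    (hX : ClassX4 W 3) (hsurj : Surj W 3)
    (C : VariableChange ℚ) (hC : C • V.quadraticTwist (-(3 : ℚ)) = W)
    (hgood : V.HasGoodReductionAtPrime 3) (ha3 : V.frobeniusTrace 3 = 0)
    (hrV : V.analyticRank = 0) (hrW : W.analyticRank = 0)
    {qV qW : ℚ} (hqV : shaAn V = (qV : ℂ)) (hqW : shaAn W = (qW : ℂ))
    (hvV : padicValRat 3 qV = 0) (hvW : padicValRat 3 qW = 0)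
    (htamV : padicValNat 3 V.tamagawaProduct = 0) (htamW : padicValNat 3 W.tamagawaProduct = 0) :
    BSDp W 3 ∧ BSDp V 3 :=
  XGssCyclotomicThreeSharp.bsdp_of_units_of_surj V W hKob hKO hPol hGZK hmod hmodD C hC hgood
    ha3 hsurj hX.2.1 hrV hrW hqV hqW hvV hvW htamV htamW

end Summit.BirchSwinnertonDyer.Rank1Residual.Additive

end
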